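import Mathlib.Geometry.Manifold.BumpFunction
import Mathlib.MeasureTheory.Function.LocallyIntegrable
import Mathlib.MeasureTheory.Integral.Bochner.Basic
import HarnessLib

/-!
# The fundamental lemma of the calculus of variations, one-sided (inequality) form

The one-sided companion of `eqOn_zero_of_forall_integral_mul_contMDiff_eq_zero`
(`LinearHeatVeryWeakClassical.lean`): let `X` be a `C^∞` manifold modelled on a finite-dimensional
real normed space (Hausdorff, Borel), `μ` a measure on `X` which is finite on compact sets and
charges open sets, `O ⊆ X` open, `E` continuous on `O` and `K` a real constant.

* `le_of_forall_integral_mul_contMDiff_le` — if `∫ E ζ dμ ≤ K ∫ ζ dμ` for every nonnegative `C^∞`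
  function `ζ` with compact support inside `O`, then `E ≤ K` on `O`;
* `le_of_forall_integral_mul_contMDiff_ge` — if `K ∫ ζ dμ ≤ ∫ E ζ dμ` for all such `ζ`, then
  `K ≤ E` on `O`.

Proof: if `E p₀ > K`, then `E > K + ε` with `ε = (E p₀ − K)/2 > 0` on an open neighbourhood
`U ⊆ O` of `p₀`; a smooth bump function `ζ ≥ 0` with `tsupport ζ ⊆ U` and `ζ = 1` near `p₀` has
`∫ ζ dμ > 0` (the measure charges the open set `{ζ ≠ 0} ∋ p₀`), so
`∫ E ζ dμ ≥ (K + ε) ∫ ζ dμ > K ∫ ζ dμ`, a contradiction. The lower bound follows by applying the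
upper bound to `−E` and `−K`. This is the distributional statement "a continuous function which
is `≤ K` (as a distribution, tested against nonnegative test functions) is `≤ K` pointwise", used
to pass from tested (`L¹`-dual) bounds to pointwise bounds, e.g. in ultracontractivity arguments.

Everything is proved; no definitions, no named facts.

## References

* L. C. Evans, *Partial differential equations*, 2nd ed., AMS (2010), §7.1.1 (weak formulations
  and test functions). [Evans2010]
* L. Hörmander, *The analysis of linear partial differential operators I*, Springer (1983),
  Thm. 1.2.5 and Thm. 2.1.7 (density of test functions; nonnegative distributions).
  [HormanderALPDO1]
-/

noncomputable section

open Bundle Set Function Filter MeasureTheory Measure TopologicalSpace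
open scoped Manifold ContDiff Topology ENNReal NNReal

namespace Literature.Geometry.Riemannian

section Inequality

variable {X : Type*} [TopologicalSpace X]
  {EX : Type*} [NormedAddCommGroup EX] [NormedSpace ℝ EX] [FiniteDimensional ℝ EX]
  {HX : Type*} [TopologicalSpace HX] {J : ModelWithCorners ℝ EX HX}
  [ChartedSpace HX X] [IsManifold J ∞ X] [T2Space X]
  [MeasurableSpace X] [BorelSpace X]

/-- **Fundamental lemma of the calculus of variations, upper-bound form**, for continuous functions
on an open subset of a manifold, with nonnegative smooth compactly supported test functions (smooth
bump functions): if `E` is continuous on the open set `O`, the measure `μ` is finite on compact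
sets and charges open sets, and `∫ E ζ dμ ≤ K ∫ ζ dμ` for every nonnegative `C^∞` function `ζ`
with compact support inside `O`, then `E ≤ K` on `O`. [folklore] -/
theorem le_of_forall_integral_mul_contMDiff_le (μ : Measure X)
    [IsFiniteMeasureOnCompacts μ] [μ.IsOpenPosMeasure] {O : Set X} (hO : IsOpen O) {E : X → ℝ}
    (hE : ContinuousOn E O) {K : ℝ}
    (h : ∀ ζ : X → ℝ, ContMDiff J 𝓘(ℝ, ℝ) ∞ ζ → HasCompactSupport ζ → tsupport ζ ⊆ O →
      (∀ p, 0 ≤ ζ p) → ∫ p, E p * ζ p ∂μ ≤ K * ∫ p, ζ p ∂μ) : ∀ p ∈ O, E p ≤ K := by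
  intro p₀ hp₀
  rcases le_or_gt (E p₀) K with hle | hlt
  · exact hle
  exfalso
  set ε : ℝ := (E p₀ - K) / 2 with hε
  have hεpos : 0 < ε := by rw [hε]; linarith
  -- a neighbourhood of `p₀` inside `O` on which `E > K + ε`, and a bump function supported in it
  set U : Set X := O ∩ E ⁻¹' Ioi (K + ε) with hU
  have hUo : IsOpen U := hE.isOpen_inter_preimage hO isOpen_Ioi
  have hp₀U : p₀ ∈ U := ⟨hp₀, by simp only [mem_preimage, mem_Ioi, hε]; linarith⟩
  obtain ⟨f, -, hfU⟩ := (SmoothBumpFunction.nhds_basis_tsupport (I := J) p₀).mem_iff.1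
    (hUo.mem_nhds hp₀U)
  have hfO : tsupport f ⊆ O := hfU.trans inter_subset_left
  have hfc : Continuous (f : X → ℝ) := f.contMDiff.continuous
  have hfnn : ∀ p, 0 ≤ f p := fun p ↦ f.nonneg
  have h0 := h f f.contMDiff f.hasCompactSupport hfO hfnn
  -- `∫ E f ≥ (K + ε) ∫ f` and `∫ f > 0`
  have hEf : Continuous fun p ↦ E p * f p := by
    refine continuous_of_tsupport fun p hp ↦ ?_
    have hpO : p ∈ O := hfO (tsupport_mul_subset_right hp)
    exact ((hE.continuousWithinAt hpO).continuousAt (hO.mem_nhds hpO)).mul hfc.continuousAt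
  have hEfint : Integrable (fun p ↦ E p * f p) μ :=
    hEf.integrable_of_hasCompactSupport f.hasCompactSupport.mul_left
  have hfint : Integrable (fun p ↦ (f p : ℝ)) μ :=
    hfc.integrable_of_hasCompactSupport f.hasCompactSupport
  have hfpos : 0 < ∫ p, f p ∂μ := by
    rw [integral_pos_iff_support_of_nonneg hfnn hfint]
    refine hfc.isOpen_support.measure_pos μ ⟨p₀, ?_⟩
    rw [mem_support, f.eq_one]
    exact one_ne_zero
  have hge : (K + ε) * ∫ p, f p ∂μ ≤ ∫ p, E p * f p ∂μ := by
    rw [← MeasureTheory.integral_const_mul]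
    refine integral_mono (hfint.const_mul _) hEfint fun p ↦ ?_
    by_cases hp : f p = 0
    · simp [hp]
    · have hpU : p ∈ U := hfU (subset_tsupport _ hp)
      have : K + ε < E p := hpU.2
      exact mul_le_mul_of_nonneg_right this.le (hfnn p)
  have : 0 < ε * ∫ p, f p ∂μ := mul_pos hεpos hfpos
  linarith

/-- **Fundamental lemma of the calculus of variations, lower-bound form**, for continuous functions
on an open subset of a manifold, with nonnegative smooth compactly supported test functions: if
`E` is continuous on the open set `O`, the measure `μ` is finite on compact sets and charges open
sets, and `K ∫ ζ dμ ≤ ∫ E ζ dμ` for every nonnegative `C^∞` function `ζ` with compact support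
inside `O`, then `K ≤ E` on `O` (the upper-bound form applied to `−E` and `−K`). [folklore] -/
theorem le_of_forall_integral_mul_contMDiff_ge (μ : Measure X)
    [IsFiniteMeasureOnCompacts μ] [μ.IsOpenPosMeasure] {O : Set X} (hO : IsOpen O) {E : X → ℝ}
    (hE : ContinuousOn E O) {K : ℝ}
    (h : ∀ ζ : X → ℝ, ContMDiff J 𝓘(ℝ, ℝ) ∞ ζ → HasCompactSupport ζ → tsupport ζ ⊆ O →
      (∀ p, 0 ≤ ζ p) → K * ∫ p, ζ p ∂μ ≤ ∫ p, E p * ζ p ∂μ) : ∀ p ∈ O, K ≤ E p := by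
  intro p₀ hp₀
  have hneg : -E p₀ ≤ -K := by
    refine le_of_forall_integral_mul_contMDiff_le (J := J) μ hO hE.neg
      (fun ζ h1 h2 h3 h4 ↦ ?_) p₀ hp₀
    show ∫ p, -E p * ζ p ∂μ ≤ -K * ∫ p, ζ p ∂μ
    have e : (fun p ↦ -E p * ζ p) = fun p ↦ -(E p * ζ p) := by funext p; ring
    rw [e, integral_neg, neg_mul]
    exact neg_le_neg (h ζ h1 h2 h3 h4)
  linarith

end Inequality

end Literature.Geometry.Riemannian

end
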